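import Mathlib.Analysis.Calculus.IteratedDeriv.Lemmas
import Mathlib.Analysis.Calculus.Deriv.ZPow
import Mathlib.Order.Filter.Extr
import Mathlib.Topology.Algebra.Order.Field
import Mathlib.Tactic.FieldSimp
import Mathlib.Tactic.Positivity
import Literature.MathematicalPhysics.StatisticalMechanics.Crystallization
import HarnessLib

/-!
# The normalised Mie `(2p, p)` pair potential

Topic `MathematicalPhysics/StatisticalMechanics`; definition item `defn-miePotential` (routes
`AtomisticToContinuum/Crystallization/BrittleMieDescent` and `SteepnessLadderOneCentre`).

A deliberately LIGHT module: it imports only Mathlib and `Crystallization.lean` (itself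
Mathlib-only), so that the `(2q, q)`-ladder statements of both routes can be stated over
`miePotential q` with an import cone free of `Theil2006` and of the barrier file
`Literature.Barriers.AtomisticToContinuum.LocalizedPotentialsExcludeLennardJones` (whose `mieWith`
family this specialises: `miePotential p = mieWith (1/(2p)) (1/p) (2p) p` holds by `rfl` and is to
be recorded THERE, downstream — never imported here).

## The potential

`miePotential p r = (1/(2p)) r^{-2p} - (1/p) r^{-p}` — the Mie `(n, m) = (2p, p)` inverse-power
pair potential `V(r) = A r⁻ⁿ - B r⁻ᵐ` (Mie 1903; Bétermin 2023, §1; the barrier file's `mieWith`)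
in the normalisation of Blanc–Lewin 2015, (3), used by the tree's `lennardJones` (`p = 6`):
equilibrium distance `r = 1`, well depth `V(1) = -1/(2p)` (`miePotential_one`), the global
minimum (`neg_one_div_le_miePotential`: `V(r) + 1/(2p) = (1/(2p))(r⁻ᵖ - 1)² ≥ 0`), and curvature
`V''(1) = p` there. `V(0) = 0` by Mathlib's `0⁻¹ = 0` (irrelevant: configurations consist of
distinct points).

## Contents

`miePotential`, `miePotential_apply` (`rfl`), `miePotential_six : miePotential 6 = lennardJones`,
`miePotential_one`, `neg_one_div_le_miePotential`, `miePotential_eq_sq_sub` (completed square).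

Item `defn-miePotential-2` (route `BrittleRungDescent`; same notion, fuller API), appended below
the original content, Mathlib-only as before:
* shape of the well — `isMinOn_miePotential_one` (minimum at `r = 1`),
  `miePotential_eq_neg_one_div_iff` / `neg_one_div_lt_miePotential` (the minimum is strict on
  `[0, ∞)`), `strictAntiOn_miePotential` (on `(0, 1]`), `strictMonoOn_miePotential` (on
  `[1, ∞)`), `miePotential_neg` (`V_p < 0` beyond `r = 1`), `tendsto_miePotential_atTop`
  (`V_p → 0`);
* calculus at the well — `contDiffAt_miePotential` (`r ≠ 0`), `hasDerivAt_miePotential` /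
  `deriv_miePotential` (`V_p'(r) = r^{-(p+1)} - r^{-(2p+1)}`), `deriv_miePotential_one`
  (`V_p'(1) = 0`), `iter_deriv_two_miePotential`
  (`V_p''(r) = (2p+1) r^{-(2p+2)} - (p+1) r^{-(p+2)}`) and `iter_deriv_two_miePotential_one`:
  **`V_p''(1) = p`** (at `p = 6`: `V_LJ''(1) = 13 - 7 = 6`).
The identification `miePotential p = mieWith (1/(2p)) (1/p) (2p) p` (`rfl`) is recorded in the
barrier file as `Literature.Barriers.AtomisticToContinuum.miePotential_eq_mieWith`, not here.
-/

noncomputable section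

namespace Literature.MathematicalPhysics.StatisticalMechanics

/-- The **normalised Mie `(2p, p)` pair potential** `V_p(r) = (1/(2p)) r^{-2p} - (1/p) r^{-p}`
(Mie's `A r⁻ⁿ - B r⁻ᵐ` with `n = 2p`, `m = p`, normalised as in Blanc–Lewin 2015, (3): minimum
`-1/(2p)` at `r = 1`; `p = 6` is the tree's `lennardJones`, `miePotential_six`).
[cite: BlancLewin2015, §1.1 (3) (the normalisation; p = 6)] -/
def miePotential (p : ℕ) (r : ℝ) : ℝ :=
  1 / (2 * (p : ℝ)) * r⁻¹ ^ (2 * p) - 1 / (p : ℝ) * r⁻¹ ^ p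

/-- Unfolding lemma. [folklore] -/
@[simp] theorem miePotential_apply (p : ℕ) (r : ℝ) :
    miePotential p r = 1 / (2 * (p : ℝ)) * r⁻¹ ^ (2 * p) - 1 / (p : ℝ) * r⁻¹ ^ p := rfl

/-- **`p = 6` is the Lennard-Jones potential** of `Crystallization.lean`:
`(1/12) r⁻¹² - (1/6) r⁻⁶`. [cite: BlancLewin2015, §1.1 (3)] -/
theorem miePotential_six : miePotential 6 = lennardJones := by
  funext r
  simp only [miePotential_apply, lennardJones]
  norm_num

/-- The completed square: `V_p(r) = (1/(2p)) (r⁻ᵖ - 1)² - 1/(2p)` (`p ≠ 0`). [folklore] -/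
theorem miePotential_eq_sq_sub {p : ℕ} (hp : p ≠ 0) (r : ℝ) :
    miePotential p r = 1 / (2 * (p : ℝ)) * (r⁻¹ ^ p - 1) ^ 2 - 1 / (2 * (p : ℝ)) := by
  have hp' : (p : ℝ) ≠ 0 := Nat.cast_ne_zero.2 hp
  rw [miePotential_apply, pow_mul']
  field_simp
  ring

/-- **Well depth**: `V_p(1) = -1/(2p)` (`p ≠ 0`; Blanc–Lewin's `min V_LJ = -1/12` at `p = 6`).
[folklore] -/
theorem miePotential_one {p : ℕ} (hp : p ≠ 0) : miePotential p 1 = -1 / (2 * (p : ℝ)) := by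
  rw [miePotential_eq_sq_sub hp]
  simp only [inv_one, one_pow, sub_self, ne_eq, OfNat.ofNat_ne_zero, not_false_eq_true,
    zero_pow, mul_zero, zero_sub, neg_div]

/-- **Lower bound**: `-1/(2p) ≤ V_p(r)` for every `r` (`p ≠ 0`), with equality at `r = 1`.
[folklore] -/
theorem neg_one_div_le_miePotential {p : ℕ} (hp : p ≠ 0) (r : ℝ) :
    -1 / (2 * (p : ℝ)) ≤ miePotential p r := by
  rw [miePotential_eq_sq_sub hp, neg_div]
  have : (0 : ℝ) ≤ 1 / (2 * (p : ℝ)) * (r⁻¹ ^ p - 1) ^ 2 := by positivity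
  linarith

/-! ## Shape of the well (item `defn-miePotential-2`): minimum at `r = 1`, strictness, monotonicity, decay

Everything in this section is elementary algebra on the completed square
`V_p(r) = (1/(2p)) (r⁻ᵖ - 1)² - 1/(2p)` (`miePotential_eq_sq_sub`): `u = r⁻ᵖ` is strictly
decreasing in `r > 0`, `≥ 1` on `(0, 1]` and `≤ 1` on `[1, ∞)`. -/

/-- **Minimum at `r = 1`** (`p ≠ 0`): the equilibrium distance `1` is a global minimiser of
`V_p` (`V_p(1) = -1/(2p) ≤ V_p(r)`, `miePotential_one`, `neg_one_div_le_miePotential`).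
[cite: BlancLewin2015, §1.1 (3)] -/
theorem isMinOn_miePotential_one {p : ℕ} (hp : p ≠ 0) : IsMinOn (miePotential p) Set.univ 1 :=
  isMinOn_univ_iff.2 fun r => (miePotential_one hp).trans_le (neg_one_div_le_miePotential hp r)

/-- **The minimum is strict on the physical half-line**: for `0 ≤ r` and `p ≠ 0`,
`V_p(r) = -1/(2p) ↔ r = 1` (for even `p` the unphysical point `r = -1` is a minimiser too,
whence `0 ≤ r`). [folklore] -/
theorem miePotential_eq_neg_one_div_iff {p : ℕ} (hp : p ≠ 0) {r : ℝ} (hr : 0 ≤ r) :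
    miePotential p r = -1 / (2 * (p : ℝ)) ↔ r = 1 := by
  refine ⟨fun h => ?_, fun h => h ▸ miePotential_one hp⟩
  have hp0 : 0 < p := Nat.pos_of_ne_zero hp
  have hc : (0 : ℝ) < 1 / (2 * (p : ℝ)) := by positivity
  have h0 : 1 / (2 * (p : ℝ)) * (r⁻¹ ^ p - 1) ^ 2 = 0 := by
    rw [miePotential_eq_sq_sub hp, neg_div] at h
    linarith
  have h1 : r⁻¹ ^ p - 1 = 0 :=
    (pow_eq_zero_iff two_ne_zero).1 ((mul_eq_zero.1 h0).resolve_left hc.ne')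
  rwa [sub_eq_zero, pow_eq_one_iff_of_nonneg (inv_nonneg.2 hr) hp, inv_eq_one] at h1

/-- Strict lower bound off the minimiser: `-1/(2p) < V_p(r)` for `0 ≤ r`, `r ≠ 1`, `p ≠ 0`.
[folklore] -/
theorem neg_one_div_lt_miePotential {p : ℕ} (hp : p ≠ 0) {r : ℝ} (hr : 0 ≤ r) (hr1 : r ≠ 1) :
    -1 / (2 * (p : ℝ)) < miePotential p r :=
  (neg_one_div_le_miePotential hp r).lt_of_ne fun h =>
    hr1 ((miePotential_eq_neg_one_div_iff hp hr).1 h.symm)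

/-- `V_p` is strictly decreasing on `(0, 1]` (`p ≠ 0`): the repulsive side of the well.
[folklore] -/
theorem strictAntiOn_miePotential {p : ℕ} (hp : p ≠ 0) :
    StrictAntiOn (miePotential p) (Set.Ioc 0 1) := by
  rintro r ⟨hr0, -⟩ s ⟨hs0, hs1⟩ hrs
  have hp0 : 0 < p := Nat.pos_of_ne_zero hp
  have hc : (0 : ℝ) < 1 / (2 * (p : ℝ)) := by positivity
  have hu : s⁻¹ ^ p < r⁻¹ ^ p :=
    pow_lt_pow_left₀ ((inv_lt_inv₀ hs0 hr0).2 hrs) (inv_nonneg.2 hs0.le) hp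
  have hs' : (1 : ℝ) ≤ s⁻¹ ^ p := one_le_pow₀ ((one_le_inv₀ hs0).2 hs1)
  have h2 : (s⁻¹ ^ p - 1) ^ 2 < (r⁻¹ ^ p - 1) ^ 2 :=
    pow_lt_pow_left₀ (by linarith) (by linarith) two_ne_zero
  show miePotential p s < miePotential p r
  rw [miePotential_eq_sq_sub hp, miePotential_eq_sq_sub hp]
  linarith [mul_lt_mul_of_pos_left h2 hc]

/-- `V_p` is strictly increasing on `[1, ∞)` (`p ≠ 0`): the attractive side of the well.
[folklore] -/
theorem strictMonoOn_miePotential {p : ℕ} (hp : p ≠ 0) :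
    StrictMonoOn (miePotential p) (Set.Ici 1) := by
  intro r hr s _ hrs
  have hr1 : (1 : ℝ) ≤ r := hr
  have hr0 : (0 : ℝ) < r := one_pos.trans_le hr1
  have hs0 : (0 : ℝ) < s := hr0.trans hrs
  have hp0 : 0 < p := Nat.pos_of_ne_zero hp
  have hc : (0 : ℝ) < 1 / (2 * (p : ℝ)) := by positivity
  have hu : s⁻¹ ^ p < r⁻¹ ^ p :=
    pow_lt_pow_left₀ ((inv_lt_inv₀ hs0 hr0).2 hrs) (inv_nonneg.2 hs0.le) hp
  have hr' : r⁻¹ ^ p ≤ 1 := pow_le_one₀ (inv_nonneg.2 hr0.le) (inv_le_one_of_one_le₀ hr1)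
  have hs' : (0 : ℝ) ≤ s⁻¹ ^ p := by positivity
  have h2 : (r⁻¹ ^ p - 1) ^ 2 < (s⁻¹ ^ p - 1) ^ 2 := by
    nlinarith [mul_pos (sub_pos.2 hu) (by linarith : (0 : ℝ) < 2 - r⁻¹ ^ p - s⁻¹ ^ p)]
  show miePotential p r < miePotential p s
  rw [miePotential_eq_sq_sub hp, miePotential_eq_sq_sub hp]
  linarith [mul_lt_mul_of_pos_left h2 hc]

/-- Beyond the equilibrium distance the potential is attractive (negative): `V_p(r) < 0` for
`1 < r` (`p ≠ 0`; indeed `V_p(r) = (r⁻ᵖ/p)(r⁻ᵖ/2 - 1)` and `0 < r⁻ᵖ < 1`). [folklore] -/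
theorem miePotential_neg {p : ℕ} (hp : p ≠ 0) {r : ℝ} (hr : 1 < r) : miePotential p r < 0 := by
  have hp0 : 0 < p := Nat.pos_of_ne_zero hp
  have hr0 : (0 : ℝ) < r := one_pos.trans hr
  have hu0 : (0 : ℝ) < r⁻¹ ^ p := by positivity
  have hu1 : r⁻¹ ^ p < 1 := pow_lt_one₀ (inv_nonneg.2 hr0.le) (inv_lt_one_of_one_lt₀ hr) hp
  have hc : (0 : ℝ) < 1 / (p : ℝ) := by positivity
  rw [miePotential_apply, pow_mul', sub_neg,
    show 1 / (2 * (p : ℝ)) * (r⁻¹ ^ p) ^ 2 = 1 / (p : ℝ) * r⁻¹ ^ p * (r⁻¹ ^ p / 2) by ring]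
  calc 1 / (p : ℝ) * r⁻¹ ^ p * (r⁻¹ ^ p / 2)
      < 1 / (p : ℝ) * r⁻¹ ^ p * 1 := mul_lt_mul_of_pos_left (by linarith) (mul_pos hc hu0)
    _ = 1 / (p : ℝ) * r⁻¹ ^ p := mul_one _

/-- `V_p(r) → 0` as `r → ∞` (`p ≠ 0`). [folklore] -/
theorem tendsto_miePotential_atTop {p : ℕ} (hp : p ≠ 0) :
    Filter.Tendsto (miePotential p) Filter.atTop (nhds 0) := by
  have h : ∀ n : ℕ, n ≠ 0 →
      Filter.Tendsto (fun r : ℝ => r⁻¹ ^ n) Filter.atTop (nhds 0) := fun n hn => by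
    simpa [zero_pow hn] using (tendsto_inv_atTop_zero (𝕜 := ℝ)).pow n
  have hV : miePotential p =
      fun r => 1 / (2 * (p : ℝ)) * r⁻¹ ^ (2 * p) - 1 / (p : ℝ) * r⁻¹ ^ p := rfl
  have := ((h (2 * p) (by omega)).const_mul (1 / (2 * (p : ℝ)))).sub
    ((h p hp).const_mul (1 / (p : ℝ)))
  rw [mul_zero, mul_zero, sub_zero] at this
  rw [hV]
  exact this

/-! ## Calculus at the well (item `defn-miePotential-2`): `V_p'`, `V_p''`, `V_p'(1) = 0`, `V_p''(1) = p`

`V_p` is smooth away from the origin; derivatives are Mathlib's `deriv` / `deriv^[2]` of the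
globally defined function (the tree's convention, cf. `Theil2006.IsAdmissible`). The two
two-term inverse-power computations are done once for general coefficients and exponents
(private helpers; the second is the computation `iter_deriv_two_mieWith` of the barrier file,
repeated here so as not to import it) and then specialised to `A = 1/(2p)`, `B = 1/p`,
exponents `(2p, p)`; for `p = 0` (`V_0 = 0` by `1/0 = 0`) all formulas hold trivially. -/

/-- `s ↦ A s⁻ᵐ - B s⁻ⁿ` has derivative `-m A r^{-(m+1)} + n B r^{-(n+1)}` at `r ≠ 0`. [folklore] -/
private theorem hasDerivAt_invPow_sub (A B : ℝ) (m n : ℕ) {r : ℝ} (hr : r ≠ 0) :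
    HasDerivAt (fun s : ℝ => A * s⁻¹ ^ m - B * s⁻¹ ^ n)
      (-(m : ℝ) * A * r⁻¹ ^ (m + 1) + (n : ℝ) * B * r⁻¹ ^ (n + 1)) r := by
  have e : ∀ k : ℕ, (fun s : ℝ => s⁻¹ ^ k) = fun s => s ^ (-(k : ℤ)) := fun k => by
    funext s; rw [zpow_neg, zpow_natCast, inv_pow]
  have e' : ∀ k : ℕ, r ^ (-(k : ℤ) - 1) = r⁻¹ ^ (k + 1) := fun k => by
    rw [show (-(k : ℤ) - 1) = -((k + 1 : ℕ) : ℤ) by push_cast; ring, zpow_neg, zpow_natCast,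
      inv_pow]
  have h : ∀ k : ℕ, HasDerivAt (fun s : ℝ => s⁻¹ ^ k) (-(k : ℝ) * r⁻¹ ^ (k + 1)) r := fun k => by
    rw [e k, ← e' k]
    simpa using hasDerivAt_zpow (-(k : ℤ)) r (Or.inl hr)
  have key : HasDerivAt (fun s : ℝ => A * s⁻¹ ^ m - B * s⁻¹ ^ n)
      (A * (-(m : ℝ) * r⁻¹ ^ (m + 1)) - B * (-(n : ℝ) * r⁻¹ ^ (n + 1))) r :=
    ((h m).const_mul A).sub ((h n).const_mul B)
  exact key.congr_deriv (by ring)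

/-- `s ↦ A s⁻ᵐ - B s⁻ⁿ` has second derivative `m(m+1) A r^{-(m+2)} - n(n+1) B r^{-(n+2)}` at
`r ≠ 0` (the computation `iter_deriv_two_mieWith` of the barrier file
`LocalizedPotentialsExcludeLennardJones`, repeated to keep this module's imports light).
[folklore] -/
private theorem iter_deriv_two_invPow_sub (A B : ℝ) (m n : ℕ) {r : ℝ} (hr : r ≠ 0) :
    deriv^[2] (fun s : ℝ => A * s⁻¹ ^ m - B * s⁻¹ ^ n) r =
      (m * (m + 1) : ℝ) * A * r⁻¹ ^ (m + 2) - (n * (n + 1) : ℝ) * B * r⁻¹ ^ (n + 2) := by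
  have e : ∀ k : ℕ, (fun s : ℝ => s⁻¹ ^ k) = fun s => s ^ (-(k : ℤ)) := fun k => by
    funext s; rw [zpow_neg, zpow_natCast, inv_pow]
  have e' : ∀ k : ℕ, r ^ (-(k : ℤ) - 2) = r⁻¹ ^ (k + 2) := fun k => by
    rw [show (-(k : ℤ) - 2) = -((k + 2 : ℕ) : ℤ) by push_cast; ring, zpow_neg, zpow_natCast,
      inv_pow]
  have hm : ContDiffAt ℝ 2 (fun s : ℝ => A * s⁻¹ ^ m) r :=
    contDiffAt_const.mul ((contDiffAt_inv ℝ hr).pow m)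
  have hn : ContDiffAt ℝ 2 (fun s : ℝ => B * s⁻¹ ^ n) r :=
    contDiffAt_const.mul ((contDiffAt_inv ℝ hr).pow n)
  rw [← iteratedDeriv_eq_iterate, iteratedDeriv_fun_sub hm hn,
    iteratedDeriv_const_mul_field, iteratedDeriv_const_mul_field, e m, e n,
    iteratedDeriv_eq_iterate, iteratedDeriv_eq_iterate, iter_deriv_zpow, iter_deriv_zpow]
  simp only [Finset.prod_range_succ, Finset.prod_range_zero, one_mul, Nat.cast_ofNat, Int.cast_neg,
    Int.cast_natCast, Nat.cast_zero, sub_zero, Nat.cast_one]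
  rw [e' m, e' n]
  ring

/-- `V_p` is `Cⁿ` (every `n`) at every `r ≠ 0`. [folklore] -/
theorem contDiffAt_miePotential (p : ℕ) {n : WithTop ℕ∞} {r : ℝ} (hr : r ≠ 0) :
    ContDiffAt ℝ n (miePotential p) r :=
  (contDiffAt_const.mul ((contDiffAt_inv ℝ hr).pow (2 * p))).sub
    (contDiffAt_const.mul ((contDiffAt_inv ℝ hr).pow p))

/-- **`V_p'(r) = r^{-(p+1)} - r^{-(2p+1)}`** for `r ≠ 0` (`= r^{-(p+1)} (1 - r⁻ᵖ)`: negative on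
`(0, 1)`, positive on `(1, ∞)`). [folklore] -/
theorem hasDerivAt_miePotential (p : ℕ) {r : ℝ} (hr : r ≠ 0) :
    HasDerivAt (miePotential p) (r⁻¹ ^ (p + 1) - r⁻¹ ^ (2 * p + 1)) r := by
  have hV : miePotential p =
      fun s => 1 / (2 * (p : ℝ)) * s⁻¹ ^ (2 * p) - 1 / (p : ℝ) * s⁻¹ ^ p := rfl
  rw [hV]
  refine (hasDerivAt_invPow_sub _ _ (2 * p) p hr).congr_deriv ?_
  rcases Nat.eq_zero_or_pos p with rfl | hp0
  · simp
  · have hp' : (p : ℝ) ≠ 0 := Nat.cast_ne_zero.2 hp0.ne'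
    push_cast
    field_simp
    ring

/-- `V_p'(r) = r^{-(p+1)} - r^{-(2p+1)}` for `r ≠ 0`, `deriv` form. [folklore] -/
theorem deriv_miePotential (p : ℕ) {r : ℝ} (hr : r ≠ 0) :
    deriv (miePotential p) r = r⁻¹ ^ (p + 1) - r⁻¹ ^ (2 * p + 1) :=
  (hasDerivAt_miePotential p hr).deriv

/-- **The equilibrium distance is a critical point: `V_p'(1) = 0`.** [folklore] -/
theorem deriv_miePotential_one (p : ℕ) : deriv (miePotential p) 1 = 0 := by
  rw [deriv_miePotential p one_ne_zero, inv_one, one_pow, one_pow, sub_self]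

/-- **`V_p''(r) = (2p+1) r^{-(2p+2)} - (p+1) r^{-(p+2)}`** for `r ≠ 0`. [folklore] -/
theorem iter_deriv_two_miePotential (p : ℕ) {r : ℝ} (hr : r ≠ 0) :
    deriv^[2] (miePotential p) r =
      (2 * p + 1 : ℝ) * r⁻¹ ^ (2 * p + 2) - (p + 1 : ℝ) * r⁻¹ ^ (p + 2) := by
  have hV : miePotential p =
      fun s => 1 / (2 * (p : ℝ)) * s⁻¹ ^ (2 * p) - 1 / (p : ℝ) * s⁻¹ ^ p := rfl
  rw [hV, iter_deriv_two_invPow_sub _ _ (2 * p) p hr]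
  rcases Nat.eq_zero_or_pos p with rfl | hp0
  · simp
  · have hp' : (p : ℝ) ≠ 0 := Nat.cast_ne_zero.2 hp0.ne'
    push_cast
    field_simp

/-- **Curvature at the minimum: `V_p''(1) = p`** — the well stiffens linearly along the
`(2p, p)` ladder (`p = 6`: `V_LJ''(1) = 13 - 7 = 6`); this is the quantity entering convexity
windows `V'' ≥ 1` near `r = 1` of Theil-type hypotheses. [folklore] -/
theorem iter_deriv_two_miePotential_one (p : ℕ) : deriv^[2] (miePotential p) 1 = p := by
  rw [iter_deriv_two_miePotential p one_ne_zero, inv_one, one_pow, one_pow, mul_one, mul_one]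
  ring

end Literature.MathematicalPhysics.StatisticalMechanics
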